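import Literature.AlgebraicGeometry.HodgeTheory.RealSl2BlocksTimesCMInvariance
import Literature.AlgebraicGeometry.HodgeTheory.GenericAbelianThreefoldPowersHodgeClasses
import Literature.AlgebraicGeometry.Motives.HodgeThetaAnnihilatorRealBlocksTimesSymplectic
import Literature.AlgebraicGeometry.Motives.HodgeThetaSymplecticIdeal
import Mathlib.Data.Sym.Card
import Mathlib.Data.Sym.Sym2.Order
import HarnessLib

/-!
# Hodge classes on abelian varieties with slots over `A × C`, `A` with real `𝔰𝔩₂`-block data and `C` an abelian surface or threefold with `End⁰(C) = ℚ`: the invariance theorem — the coefficient tensor is killed by `⊕_τ 𝔰𝔩(V_τ)` at the `A`-places (Hazama 1989 / Moonen–Zarhin 1999 Thm. (3.2)(1), Lie step)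

Family `hodge`, layer `Literature/AlgebraicGeometry/HodgeTheory`. Research context: cell `pub-hodge-ring2`
(HONEST FRAMING: research route conditional on HC_CM; not a corollary; Q11.4-sentence-2 already refuted in
dim ≥ 3), Literature lane, programme R14 («generic × generic products», e.g. `E × S` for an elliptic curve `E`
without complex multiplication and an abelian surface `S` with `End⁰(S) = ℚ`). UNCONDITIONAL (`hHD`, `hI` are
the tree theorems `exists_isReal_hodgeModel_holds`, `hodgePQ_independent_of_hodgeModel_holds`, kept as
arguments as in the whole Betti universe); theorems only, no named fact; no step towards a summit statement.
This file is the COMPANION of `RealSl2BlocksTimesCMInvariance` (programme R4, «RM × CM», Lombardo 2016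
Lemma 3.4: the second factor `C` of CM type) with the second factor now an abelian SURFACE or THREEFOLD with
`End⁰(C) = ℚ` (Moonen–Zarhin (2.2)/(2.3) Type I(1): `Hg(C) = Sp_{2g}`), through the abstract Lie step
`HodgeStructure.wordDerAt_assemble_eq_zero_of_realBlocks_times_symplectic`
(`Motives/HodgeThetaAnnihilatorRealBlocksTimesSymplectic`).

PRINTED RESULT. Moonen–Zarhin, Math. Ann. 315 (1999), Thm. (3.2)(1) (= Hazama, Duke Math. J. 58 (1989);
Gordon's survey Thm. 7.6.2): «Let `X₁` and `X₂` be complex abelian varieties which both satisfy condition (D).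
(1) Suppose `X₁` and `X₂` contain no factors of Type 4. Then `X₁ × X₂` again satisfies (D), and either
`Hom(X₁, X₂) ≠ 0` or `Hg(X₁ × X₂) = Hg(X₁) × Hg(X₂)`» [corpus: paper:arxiv-math_9901113 p. 6]. This file is
the LIE STEP of that statement on tensors, for `X₁ = A` a carrier of real `𝔰𝔩₂`-block data (Hazama 1983 §3:
`H¹(A, ℂ) = ⊕ V_i`, `𝔥 = 𝔰𝔩₂ × ⋯ × 𝔰𝔩₂`; e.g. a non-CM elliptic curve, or `End⁰(A)` a totally real field of
degree `dim A`, Ribet 1983) and `X₂ = C` with `End⁰(C) = ℚ`, `dim C ∈ {2, 3}`, under the SIZE hypothesis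
`dim hg(A) < 2 dim C` in the form: every rational space of `ψ`-skew operators of `H¹(A)` commuting with
`End_Hdg(H¹(A))` has dimension `< dim C (2 dim C + 1) = dim 𝔰𝔭_{2 dim C}` (for an elliptic curve: `< 4`,
`finrank_lt_of_forall_skew`; this is what excludes Moonen–Zarhin's graph `Γ_φ` of (3.1) — `Hom(A, C) = 0`).

MAIN RESULT `AVSlots.exists_coeff_killed_at_real_places_of_prod_endRankOne` (and the cruder
`…_of_prod_generic`, SIZE bound `2 dim C`): the statement of the companion's
`AVSlots.exists_coeff_killed_at_real_places_of_prod_cmType` VERBATIM (a Hodge-adapted pair basis `(c_i^0, c_i^1)`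
of `H¹(C) ⊗ ℂ`; every rational `(p,p)`-class on `X` with slots over `A × C` is `∑_w a(w) · (letters)_w` with
`a(U, −)` killed by every trace-free `N` placed at the positions of each `A`-place `τ`), with the hypothesis
`IsOfCMType C` replaced by `finrank_ℚ End⁰(C) = 1`, `dim C = 2 ∨ dim C = 3` and the SIZE hypothesis — so that
the evaluation pipeline of programme R4 (`RealSl2BlocksTimesCM{HodgeClasses, ProductSpan, DivisorClasses}`)
runs with a generic surface or threefold in place of the CM factor (file `RealSl2BlocksTimesGenericProducts`).

PROOF = the companion's proof with the CM commutant replaced by the three inputs of the abstract Lie step for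
`H¹(C)`: (RIGID) `SymplecticTheta.mem_spanC_of_skew` (`dim C = 2`) / `SymplecticThetaSix.mem_spanC_of_skew`
(`dim C = 3`) — every admissible rational Lie algebra of `H¹(C)` complexifies to `𝔰𝔭_{2g}`; (IDEAL)
`SymplecticIdeal.theta_mem_of_ne_bot_hodge` — `𝔰𝔭` is simple, in the form «a non-zero `𝔰𝔭`-stable space of
skew operators contains `Θ`»; (SIZE) the `dim C (2 dim C + 1) = dim 𝔰𝔭` linearly independent `ψ_C`-skew operators
`ψ_C(e_i, ·) e_j + ψ_C(e_j, ·) e_i` (`i ≤ j`) of a basis (`linearIndependent_pairOp_basis`, `card_pairs_le`)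
against the hypothesis on `A` (the cruder form with `2 dim C` rank-one operators `ψ_C(e_i, ·) e_i`,
`linearIndependent_smulRight_self`, is kept as `…_of_prod_generic`).

## References

* [MoonenZarhin1999LowDim] B. Moonen, Yu. Zarhin, Math. Ann. 315 (1999), §2 (2.2)–(2.3), §3 (3.1) and
  Thm. (3.2)(1) [corpus: paper:arxiv-math_9901113 p. 5–6]. [cite: MoonenZarhin1999LowDim, §3 Thm. (3.2)(1)]
* [Hazama1989] F. Hazama, *Algebraic cycles on nonsimple abelian varieties*, Duke Math. J. 58 (1989) 31–37.
  [cite: Hazama1989, Thm. (= Gordon 7.6.2)]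
* [Gordon1999HodgeAVSurvey] B. B. Gordon, *A survey of the Hodge conjecture for abelian varieties*, Thm. 7.6.2
  [corpus: paper:arxiv-alg-geom_9709030 p. 21]. [cite: Gordon1999HodgeAVSurvey, Thm. 7.6.2]
* [Hazama1983] F. Hazama, Tôhoku Math. J. 35 (1983), Thm. (1.1), §3 pp. 305–306. [cite: Hazama1983, §3 (pp. 305–306)]
* [Ribet1983] K. A. Ribet, Amer. J. Math. 105 (1983), Thm. 0–1. [cite: Ribet1983, Thm. 0–1]
* [Deligne1982HodgeCycles] P. Deligne, LNM 900 (1982), I §3 Prop. 3.4, §4 p. 30. [cite: Deligne1982HodgeCycles, I §3 Prop. 3.4]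
* [VoisinHodgeI2002] C. Voisin, *Hodge Theory I*, §7.1.1, §7.3.2, §11.3.3 Thm. 11.38. [cite: VoisinHodgeI2002, §7.3.2]
* [GoodmanWallachGTM255] R. Goodman, N. R. Wallach, GTM 255, §2.1.2, §4.1.1. [cite: GoodmanWallachGTM255, §2.1.2]
-/

noncomputable section

open scoped TensorProduct
open CategoryTheory Module

namespace Literature.AlgebraicGeometry.HodgeTheory

open Literature.AlgebraicTopology.SingularHomology
open Literature.AlgebraicGeometry.Motives (IsSmoothProjective AbelianVariety bettiCohomology
  ofRatClassBaseChange ofRatClassBaseChange_tmul HodgeTensorFacts hodgeTensorFacts_holds)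
open Literature.Barriers.HodgeConjecture
open Literature.AlgebraicGeometry.Motives.HodgeStructure
open Literature.AlgebraicGeometry.ComplexMultiplication
open Literature.RepresentationTheory.GeneralLinear
open Literature.NumberTheory.DiophantineGeometry

/-! ### §1 Two pieces of linear algebra: independent skew rank-one operators; skew operators are few -/

section LinearAlgebra

/-- **The rank-one operators `ω(e_i, ·) e_i` of a basis `e` are linearly independent** for a nondegenerate
bilinear form `ω` (for `ω` alternating they are `ω`-skew: root vectors of `𝔰𝔭(M, ω)`,
`SymplecticIdeal.smulRight_self_skew`). [cite: GoodmanWallachGTM255, §2.1.2] -/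
theorem linearIndependent_smulRight_self {K M I : Type*} [Field K] [AddCommGroup M] [Module K M]
    (ω : LinearMap.BilinForm K M) (hω : ω.Nondegenerate) (e : Module.Basis I K M) :
    LinearIndependent K fun i => (ω (e i)).smulRight (e i) := by
  classical
  rw [linearIndependent_iff']
  intro s c hc i hi
  have hcoef : ∀ v, c i * ω (e i) v = 0 := by
    intro v
    have h1 := congrArg (fun f : Module.End K M => f v) hc
    simp only [LinearMap.sum_apply, LinearMap.smul_apply, LinearMap.smulRight_apply, LinearMap.zero_apply,
      smul_smul] at h1
    exact linearIndependent_iff'.1 e.linearIndependent s (fun j => c j * ω (e j) v) h1 i hi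
  by_contra hci
  have hzero : ∀ v, ω (e i) v = 0 := fun v => (mul_eq_zero.1 (hcoef v)).resolve_left hci
  exact e.ne_zero i (hω.1 (e i) hzero)

/-- **Skew operators are few**: a space of operators of `V ≠ 0` that are skew for a nondegenerate bilinear
form `B` is a PROPER subspace of `End(V)` (the identity is not skew), so its dimension is `< (dim V)²` — for
`H¹` of an elliptic curve: `dim 𝔤 < 4` (`Lie Hg(E) ⊆ 𝔰𝔩₂`). [cite: GoodmanWallachGTM255, §2.1.2]
[cite: MoonenZarhin1999LowDim, §2 (2.1)] -/
theorem finrank_lt_of_forall_skew {K V : Type*} [Field K] [CharZero K] [AddCommGroup V] [Module K V]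
    [Module.Finite K V] [Nontrivial V] (B : LinearMap.BilinForm K V) (hB : B.Nondegenerate)
    (𝔤 : Submodule K (Module.End K V)) (hskew : ∀ Y ∈ 𝔤, ∀ v w, B (Y v) w + B v (Y w) = 0) :
    Module.finrank K 𝔤 < Module.finrank K V * Module.finrank K V := by
  have hne : 𝔤 ≠ ⊤ := by
    intro htop
    have h1 : (1 : Module.End K V) ∈ 𝔤 := htop ▸ Submodule.mem_top
    obtain ⟨v, hv⟩ := exists_ne (0 : V)
    refine hv (hB.1 v fun w => ?_)
    have h := hskew 1 h1 v w
    rw [Module.End.one_apply, Module.End.one_apply, ← two_smul K (B v w), smul_eq_zero] at h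
    exact h.resolve_left two_ne_zero
  have hlt := Submodule.finrank_lt hne
  rwa [Module.finrank_linearMap] at hlt

/-- **The symmetrised rank-two operators `ω(e_i, ·) e_j + ω(e_j, ·) e_i` (`i ≤ j`) of a basis `e` are linearly
independent** for a nondegenerate bilinear form `ω` over a field of characteristic zero (for `ω` alternating they
are `ω`-skew, `SymplecticIdeal.pairOp_skew`, and form the standard basis of `𝔰𝔭(M, ω) ≅ S²(M)`): test against the
`ω`-dual basis. [cite: GoodmanWallachGTM255, §2.1.2] -/
theorem linearIndependent_pairOp_basis {K M : Type*} [Field K] [CharZero K] [AddCommGroup M] [Module K M]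
    [FiniteDimensional K M] {N : ℕ} (ω : LinearMap.BilinForm K M) (hω : ω.Nondegenerate)
    (e : Module.Basis (Fin N) K M) :
    LinearIndependent K fun p : {p : Fin N × Fin N // p.1 ≤ p.2} =>
      (ω (e p.1.1)).smulRight (e p.1.2) + (ω (e p.1.2)).smulRight (e p.1.1) := by
  classical
  rw [Fintype.linearIndependent_iff]
  intro g hg q
  -- the `ω`-dual basis `d`: `ω (e j) (d k) = δ_{jk}`
  set d := ω.flip.dualBasis hω.flip e with hd
  have hed : ∀ j k, ω (e j) (d k) = if j = k then 1 else 0 := fun j k => by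
    rw [← LinearMap.BilinForm.flip_apply, hd, LinearMap.BilinForm.apply_dualBasis_left]
  -- each term tested against `d k`, `d l`
  have hterm : ∀ (p : {p : Fin N × Fin N // p.1 ≤ p.2}) (k l : Fin N),
      ω ((g p • ((ω (e p.1.1)).smulRight (e p.1.2) + (ω (e p.1.2)).smulRight (e p.1.1))) (d k)) (d l) =
        g p * (ω (e p.1.1) (d k) * ω (e p.1.2) (d l) + ω (e p.1.2) (d k) * ω (e p.1.1) (d l)) := by
    intro p k l
    simp only [LinearMap.smul_apply, LinearMap.add_apply, LinearMap.smulRight_apply, map_add, map_smul,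
      smul_eq_mul]
  have hsum : ∀ k l : Fin N, ∑ p : {p : Fin N × Fin N // p.1 ≤ p.2},
      g p * (ω (e p.1.1) (d k) * ω (e p.1.2) (d l) + ω (e p.1.2) (d k) * ω (e p.1.1) (d l)) = (0 : K) := by
    intro k l
    have h := congrArg (fun f : Module.End K M => ω (f (d k)) (d l)) hg
    simp only [LinearMap.sum_apply, map_sum, LinearMap.zero_apply, map_zero, hterm] at h
    exact h
  obtain ⟨⟨i, j⟩, hij⟩ := q
  have h := hsum i j
  rw [Finset.sum_eq_single ⟨(i, j), hij⟩] at h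
  · have hne : ω (e i) (d i) * ω (e j) (d j) + ω (e j) (d i) * ω (e i) (d j) ≠ 0 := by
      rw [hed, hed, hed, hed, if_pos rfl, if_pos rfl]
      by_cases hji : j = i
      · subst hji; rw [if_pos rfl]; norm_num
      · rw [if_neg hji, zero_mul]; norm_num
    exact (mul_eq_zero.1 h).resolve_right hne
  · rintro ⟨⟨i', j'⟩, hij'⟩ - hp
    have hp₁ : ¬(i' = i ∧ j' = j) := by
      rintro ⟨rfl, rfl⟩; exact hp rfl
    have hp₂ : ¬(j' = i ∧ i' = j) := by
      rintro ⟨rfl, rfl⟩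
      have : i' = j' := le_antisymm hij' hij
      subst this
      exact hp rfl
    have e1 : ω (e i') (d i) * ω (e j') (d j) = 0 := by
      rw [hed, hed]
      by_cases h₁ : i' = i
      · rw [if_neg (fun h₂ => hp₁ ⟨h₁, h₂⟩), mul_zero]
      · rw [if_neg h₁, zero_mul]
    have e2 : ω (e j') (d i) * ω (e i') (d j) = 0 := by
      rw [hed, hed]
      by_cases h₃ : j' = i
      · rw [if_neg (fun h₄ => hp₂ ⟨h₃, h₄⟩), mul_zero]
      · rw [if_neg h₃, zero_mul]
    change g _ * (ω (e i') (d i) * ω (e j') (d j) + ω (e j') (d i) * ω (e i') (d j)) = 0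
    rw [e1, e2, add_zero, mul_zero]
  · intro h; exact absurd (Finset.mem_univ _) h

/-- **`#{(i, j) : i ≤ j < 2g} = g(2g+1) = dim 𝔰𝔭_{2g}`.** [cite: GoodmanWallachGTM255, §2.1.2] -/
theorem card_pairs_le (g : ℕ) : Fintype.card {p : Fin (2 * g) × Fin (2 * g) // p.1 ≤ p.2} = g * (2 * g + 1) := by
  rw [← Fintype.card_congr (Sym2.sortEquiv (α := Fin (2 * g))), Sym2.card, Fintype.card_fin, Nat.choose_two_right]
  have : (2 * g + 1) * (2 * g + 1 - 1) = g * (2 * g + 1) * 2 := by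
    rw [Nat.add_sub_cancel]; ring
  rw [this, Nat.mul_div_cancel _ two_pos]

end LinearAlgebra

/-! ### §2 The invariance theorem for slots over `A × C`, `C` a generic surface or threefold -/

section Invariance

variable {A C X : AbelianVariety ℂ} {n : ℕ} {g : Fin n → (X ⟶ A.prod C)}

/-- The two elements of `Fin 2`. [folklore] -/
private theorem fin2_eq_zero_or_one₃ (r : Fin 2) : r = 0 ∨ r = 1 := by
  fin_cases r <;> simp

set_option maxHeartbeats 400000 in
open scoped Classical in
/-- **The INVARIANCE THEOREM for slots over `A × C`, `A` with real `𝔰𝔩₂`-block data, `C` an abelian surface or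
threefold with `End⁰(C) = ℚ` (Hazama 1989 / Moonen–Zarhin 1999 Thm. (3.2)(1), Lie step; Hazama 1983 §3).** Let
`ψ` be a polarization of `H¹(A(ℂ); ℚ)` with `End_Hdg` self-adjoint, `σ_τ` (`τ ∈ T`) REAL characters of
`End_Hdg(H¹(A))` whose two-dimensional eigenblocks `V_τ` decompose `H¹(A) ⊗ ℂ`, `b_τ` Hodge-adapted block bases,
such that every rational space of `ψ`-skew operators of `H¹(A)` commuting with `End_Hdg(H¹(A))` has dimension
`< dim C · (2 dim C + 1) = dim 𝔰𝔭_{2 dim C}` (SIZE; for an elliptic curve `< 4`, `finrank_lt_of_forall_skew`;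
`Hom(A, C) = 0` in Moonen–Zarhin's (3.1)); let `C` have
`finrank_ℚ End⁰(C) = 1` and `dim C ∈ {2, 3}`, and let `X` be an abelian variety with slots `g` over `A × C`. Then
there is a Hodge-adapted pair basis `(c_i^0, c_i^1)_{i < h}` of `H¹(C) ⊗ ℂ` (`c_i^0 ∈ H^{1,0}`, `c_i^1 ∈ H^{0,1}`)
such that every rational class `c` of type `(p,p)` on `X` (`p ≥ 1`) is `∑_w a(w) · x_w` in the letters
`x((j, inl τ), r) = g_j^* pr_A^* b_τ^r`, `x((j, inr i), r) = g_j^* pr_C^* c_i^r`, for a coefficient function `a`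
such that for every slot-and-place word `U`, every `A`-place `τ` and every trace-free `N ∈ M₂(ℂ)` the operator
`N` placed at the positions of place `inl τ` kills the slice `a(U, −)`: the tensor invariants of `X` are
invariants of `(⊕_τ 𝔰𝔩(V_τ)) ⊕ 0 ⊆ Lie Hg(A) ⊕ Lie Hg(C)` («`Hg(X₁ × X₂) = Hg(X₁) × Hg(X₂)`»).
[cite: MoonenZarhin1999LowDim, §3 Thm. (3.2)(1)] [cite: Hazama1989, Thm. (= Gordon 7.6.2)]
[cite: Hazama1983, Thm. (1.1) and §3 (pp. 305–306)] [cite: Ribet1983, Thm. 0–1] -/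
theorem AVSlots.exists_coeff_killed_at_real_places_of_prod_endRankOne [HodgeTensorFacts.{0, 0}]
    (hg : AVSlots (A.prod C) X g)
    (hHD : exists_isReal_hodgeModel) (hI : hodgePQ_independent_of_hodgeModel)
    {T : Type} [Fintype T] [DecidableEq T]
    (ψ : (BettiUniverse.hodge hHD (AbelianVariety.isSmoothProjective_holds (A := A)) 1).Polarization)
    (hself : ∀ a : (BettiUniverse.hodge hHD (AbelianVariety.isSmoothProjective_holds (A := A)) 1).endAlg,
      LinearMap.IsAdjointPair ψ.form ψ.form (a : Module.End ℚ (bettiCohomology A.X 1))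
        (a : Module.End ℚ (bettiCohomology A.X 1)))
    (σ : T → ((BettiUniverse.hodge hHD (AbelianVariety.isSmoothProjective_holds (A := A)) 1).endAlg →+* ℂ))
    (hreal : ∀ τ, (starRingEnd ℂ).comp (σ τ) = σ τ)
    (hint : DirectSum.IsInternal fun τ =>
      (BettiUniverse.hodge hHD (AbelianVariety.isSmoothProjective_holds (A := A)) 1).eigenBlock (σ τ))
    (h2 : ∀ τ, Module.finrank ℂ
      ((BettiUniverse.hodge hHD (AbelianVariety.isSmoothProjective_holds (A := A)) 1).eigenBlock (σ τ)) = 2)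
    (b : ∀ τ, Module.Basis (Fin 2) ℂ
      ((BettiUniverse.hodge hHD (AbelianVariety.isSmoothProjective_holds (A := A)) 1).eigenBlock (σ τ)))
    (hb0 : ∀ τ, (b τ 0 : ℂ ⊗[ℚ] bettiCohomology A.X 1) ∈
      (BettiUniverse.hodge hHD (AbelianVariety.isSmoothProjective_holds (A := A)) 1).piece 1 0)
    (hb1 : ∀ τ, (b τ 1 : ℂ ⊗[ℚ] bettiCohomology A.X 1) ∈
      (BettiUniverse.hodge hHD (AbelianVariety.isSmoothProjective_holds (A := A)) 1).piece 0 1)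
    (hdimA : ∀ 𝔤₁ : Submodule ℚ (Module.End ℚ (bettiCohomology A.X 1)),
      (∀ Y ∈ 𝔤₁, ∀ a : (BettiUniverse.hodge hHD (AbelianVariety.isSmoothProjective_holds (A := A)) 1).endAlg,
        Y * (a : Module.End ℚ (bettiCohomology A.X 1)) = (a : Module.End ℚ (bettiCohomology A.X 1)) * Y) →
      (∀ Y ∈ 𝔤₁, ∀ v w, ψ.form (Y v) w + ψ.form v (Y w) = 0) → Module.finrank ℚ 𝔤₁ < C.dim * (2 * C.dim + 1))
    (hCend : Module.finrank ℚ C.endAlgebra = 1) (hCdim : C.dim = 2 ∨ C.dim = 3) :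
    ∃ (h : ℕ) (cC : Module.Basis (Fin h × Fin 2) ℂ (ℂ ⊗[ℚ] bettiCohomology C.X 1)),
      (∀ i, cC (i, 0) ∈ (BettiUniverse.hodge hHD (AbelianVariety.isSmoothProjective_holds (A := C)) 1).piece 1 0) ∧
      (∀ i, cC (i, 1) ∈ (BettiUniverse.hodge hHD (AbelianVariety.isSmoothProjective_holds (A := C)) 1).piece 0 1) ∧
      ∀ {p : ℕ}, 0 < p → ∀ {c : complexBetti X.X (2 * p)}, IsRationalClass c →
        IsOfHodgeType X.dim X.X (2 * p) p p c →
        ∃ a : (Fin (2 * p) → (Fin n × (T ⊕ Fin h)) × Fin 2) → ℂ,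
          wordEval (cupPowOneAlt ℂ (Motives.ComplexPoints X.X) (2 * p))
            (fun jr : (Fin n × (T ⊕ Fin h)) × Fin 2 => complexBetti.map (g jr.1.1).hom.hom.hom 1
              (Sum.elim
                (fun τ => complexBetti.map (Motives.AbelianVariety.fst A C).hom.hom.hom 1
                  (ofRatClassBaseChange (Motives.ComplexPoints A.X) 1 (b τ jr.2 : ℂ ⊗[ℚ] bettiCohomology A.X 1)))
                (fun i => complexBetti.map (Motives.AbelianVariety.snd A C).hom.hom.hom 1
                  (ofRatClassBaseChange (Motives.ComplexPoints C.X) 1 (cC (i, jr.2))))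
                jr.1.2)) a = c ∧
          ∀ (U : Fin (2 * p) → Fin n × (T ⊕ Fin h)) (τ : T) (N : Matrix (Fin 2) (Fin 2) ℂ), N.trace = 0 →
            wordDerAt ℂ (colourOp ℂ (fun t => (U t).2) (Sum.inl τ) N) (wordSlice a U) = 0 := by
  classical
  -- the setting
  have hXA : IsSmoothProjective A.dim A.X := AbelianVariety.isSmoothProjective_holds
  have hXC : IsSmoothProjective C.dim C.X := AbelianVariety.isSmoothProjective_holds
  have hXP : IsSmoothProjective (A.prod C).dim (A.prod C).X := AbelianVariety.isSmoothProjective_holds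
  haveI : Module.Finite ℚ (bettiCohomology A.X 1) := finite_bettiCohomology_one A
  haveI : Module.Finite ℚ (bettiCohomology C.X 1) := finite_bettiCohomology_one C
  haveI : Module.Finite ℚ (bettiCohomology (A.prod C).X 1) := finite_bettiCohomology_one (A.prod C)
  have hodd : Odd (((1 : ℕ) : ℤ)) := ⟨0, by norm_num⟩
  -- §2: the pair basis of `H¹(C) ⊗ ℂ`
  obtain ⟨h, cC, hcC0, hcC1⟩ := exists_hodgeAdapted_pairBasis (BettiUniverse.hodge hHD hXC 1) (by norm_num)
    (BettiUniverse.hodge_isEffective hHD hXC 1)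
  have hcC0' : ∀ i, cC (i, 0) ∈ (BettiUniverse.hodge hHD hXC 1).piece 1 0 := fun i => by simpa using hcC0 i
  have hcC1' : ∀ i, cC (i, 1) ∈ (BettiUniverse.hodge hHD hXC 1).piece 0 1 := fun i => by simpa using hcC1 i
  refine ⟨h, cC, hcC0', hcC1', ?_⟩
  intro p hp c hcQ hc
  -- the presentation `H¹(A × C) = pr_A^* H¹(A) ⊕ pr_C^* H¹(C)` and its complexification
  set ι₁ := HOneProduct.pullFst A C with hι₁
  set π₁ := HOneProduct.pullInl A C with hπ₁
  set ι₂ := HOneProduct.pullSnd A C with hι₂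
  set π₂ := HOneProduct.pullInr A C with hπ₂
  have hπι₁ : π₁ ∘ₗ ι₁ = LinearMap.id := HOneProduct.pullInl_comp_pullFst
  have hπι₂ : π₂ ∘ₗ ι₂ = LinearMap.id := HOneProduct.pullInr_comp_pullSnd
  have hπ₁ι₂ : π₁ ∘ₗ ι₂ = 0 := HOneProduct.pullInl_comp_pullSnd
  have hπ₂ι₁ : π₂ ∘ₗ ι₁ = 0 := HOneProduct.pullInr_comp_pullFst
  have hsum : ι₁ ∘ₗ π₁ + ι₂ ∘ₗ π₂ = LinearMap.id := HOneProduct.pullFst_comp_pullInl_add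
  have hπι₁C : π₁.baseChange ℂ ∘ₗ ι₁.baseChange ℂ = LinearMap.id := by
    rw [← LinearMap.baseChange_comp, hπι₁, LinearMap.baseChange_id]
  have hπι₂C : π₂.baseChange ℂ ∘ₗ ι₂.baseChange ℂ = LinearMap.id := by
    rw [← LinearMap.baseChange_comp, hπι₂, LinearMap.baseChange_id]
  have hπ₁ι₂C : π₁.baseChange ℂ ∘ₗ ι₂.baseChange ℂ = 0 := by
    rw [← LinearMap.baseChange_comp, hπ₁ι₂, LinearMap.baseChange_zero]
  have hπ₂ι₁C : π₂.baseChange ℂ ∘ₗ ι₁.baseChange ℂ = 0 := by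
    rw [← LinearMap.baseChange_comp, hπ₂ι₁, LinearMap.baseChange_zero]
  have hsumC : ι₁.baseChange ℂ ∘ₗ π₁.baseChange ℂ + ι₂.baseChange ℂ ∘ₗ π₂.baseChange ℂ = LinearMap.id := by
    rw [← LinearMap.baseChange_comp, ← LinearMap.baseChange_comp, ← LinearMap.baseChange_add, hsum,
      LinearMap.baseChange_id]
  -- piece compatibility of `pr_A^*`, `pr_C^*` (pull-backs are morphisms of Hodge structures)
  have hι₁F : ∀ q : ℤ, ∀ x ∈ (BettiUniverse.hodge hHD hXA 1).piece q (((1 : ℕ) : ℤ) - q), ι₁.baseChange ℂ x ∈ (BettiUniverse.hodge hHD hXP 1).piece q (((1 : ℕ) : ℤ) - q) :=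
    fun q x hx => (BettiUniverse.pullHodgeHom hHD hI hXP hXA (Motives.AbelianVariety.fst A C).hom.hom.hom 1).map_piece_le
      q _ ⟨x, hx, rfl⟩
  have hι₂F : ∀ q : ℤ, ∀ x ∈ (BettiUniverse.hodge hHD hXC 1).piece q (((1 : ℕ) : ℤ) - q), ι₂.baseChange ℂ x ∈ (BettiUniverse.hodge hHD hXP 1).piece q (((1 : ℕ) : ℤ) - q) :=
    fun q x hx => (BettiUniverse.pullHodgeHom hHD hI hXP hXC (Motives.AbelianVariety.snd A C).hom.hom.hom 1).map_piece_le
      q _ ⟨x, hx, rfl⟩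
  -- §1: the basis `cbU` of `H¹(A × C) ⊗ ℂ` in blocks: `pr_A^* b_τ^r` and `pr_C^* c_i^r`
  set cbA : Module.Basis (T × Fin 2) ℂ (ℂ ⊗[ℚ] bettiCohomology A.X 1) :=
    (hint.collectedBasis b).reindex (Equiv.sigmaEquivProd T (Fin 2)) with hcbA
  have hcbA_apply : ∀ τr : T × Fin 2, (cbA τr : ℂ ⊗[ℚ] bettiCohomology A.X 1) = b τr.1 τr.2 := by
    rintro ⟨τ, r⟩
    simp [cbA, DirectSum.IsInternal.collectedBasis_coe, Equiv.sigmaEquivProd]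
  obtain ⟨cbx', hcbx'l, hcbx'r⟩ := exists_basis_of_presentation hπι₁C hπι₂C hπ₁ι₂C hπ₂ι₁C hsumC cbA cC
  set cbx : Module.Basis ((T ⊕ Fin h) × Fin 2) ℂ (ℂ ⊗[ℚ] bettiCohomology (A.prod C).X 1) :=
    cbx'.reindex (Equiv.sumProdDistrib T (Fin h) (Fin 2)).symm with hcbxdef
  have hcbx : ∀ tr : (T ⊕ Fin h) × Fin 2, cbx tr =
      Sum.elim (fun τ => ι₁.baseChange ℂ (b τ tr.2 : ℂ ⊗[ℚ] bettiCohomology A.X 1))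
        (fun i => ι₂.baseChange ℂ (cC (i, tr.2))) tr.1 := by
    rintro ⟨t, r⟩
    rw [hcbxdef, Module.Basis.reindex_apply, Equiv.symm_symm]
    rcases t with τ | i
    · rw [Equiv.sumProdDistrib_apply_left, hcbx'l, hcbA_apply]; rfl
    · rw [Equiv.sumProdDistrib_apply_right, hcbx'r]; rfl
  -- Hodge-adaptedness of `cbx`
  have hcbx0 : ∀ t, cbx (t, 0) ∈ (BettiUniverse.hodge hHD hXP 1).piece 1 0 := by
    intro t
    rw [hcbx]
    rcases t with τ | i
    · exact hι₁F 1 _ (by simpa using hb0 τ)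
    · exact hι₂F 1 _ (by simpa using hcC0' i)
  have hcbx1 : ∀ t, cbx (t, 1) ∈ (BettiUniverse.hodge hHD hXP 1).piece 0 1 := by
    intro t
    rw [hcbx]
    rcases t with τ | i
    · have e : (((1 : ℕ) : ℤ) - 0) = 1 := by norm_num
      have h01 := hι₁F 0 _ (by rw [e]; exact hb1 τ)
      rwa [e] at h01
    · have e : (((1 : ℕ) : ℤ) - 0) = 1 := by norm_num
      have h01 := hι₂F 0 _ (by rw [e]; exact hcC1' i)
      rwa [e] at h01
  -- bases indexed by `Fin M`: the block basis `cbσ` and the rational basis `eC`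
  set eQ := Module.finBasis ℚ (bettiCohomology (A.prod C).X 1) with heQ
  set eC : Module.Basis (Fin (Module.finrank ℚ (bettiCohomology (A.prod C).X 1))) ℂ
    (ℂ ⊗[ℚ] bettiCohomology (A.prod C).X 1) := Algebra.TensorProduct.basis ℂ eQ with heC
  set φ : Fin (Module.finrank ℚ (bettiCohomology (A.prod C).X 1)) ≃ (T ⊕ Fin h) × Fin 2 :=
    eC.indexEquiv cbx with hφ
  set cbσ : Module.Basis (Fin (Module.finrank ℚ (bettiCohomology (A.prod C).X 1))) ℂ
    (ℂ ⊗[ℚ] bettiCohomology (A.prod C).X 1) := cbx.reindex φ.symm with hcbσdef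
  have hcbσ : ∀ m, cbσ m = cbx (φ m) := fun m => by
    rw [hcbσdef, Module.Basis.reindex_apply, Equiv.symm_symm]
  -- letters
  set ρ := ofRatClassBaseChangeEquiv hXP 1 with hρ
  set v : Module.Basis _ ℂ (complexBetti (A.prod C).X 1) := cbσ.map ρ with hv
  set eL : Module.Basis _ ℂ (complexBetti (A.prod C).X 1) := eC.map ρ with heL
  have heLQ : ∀ i, IsRationalClass (eL i) := fun i => by
    rw [heL, Module.Basis.map_apply, heC, Algebra.TensorProduct.basis_apply, hρ,
      ofRatClassBaseChangeEquiv_apply, ofRatClassBaseChange_tmul, one_smul]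
    exact isRationalClass_ofRatClass _
  set κ : Fin (Module.finrank ℚ (bettiCohomology (A.prod C).X 1)) → Fin 2 := fun m => (φ m).2 with hκ
  have hv_apply : ∀ m, v m = ofRatClassBaseChange (Motives.ComplexPoints (A.prod C).X) 1 (cbx (φ m)) := fun m => by
    rw [hv, Module.Basis.map_apply, hcbσ, hρ, ofRatClassBaseChangeEquiv_apply]
  have hv0 : ∀ m, κ m = 0 → IsOfHodgeType (A.prod C).dim (A.prod C).X 1 1 0 (v m) := by
    intro m hm
    rw [hv_apply, ← BettiUniverse.mem_hodge_piece_iff hHD hI hXP (k := 1) (p := 1) (q := 0) rfl]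
    have hsplit : φ m = ((φ m).1, 0) := by
      change (φ m).2 = 0 at hm; rw [← hm]
    rw [hsplit]
    exact hcbx0 _
  have hv1 : ∀ m, κ m = 1 → IsOfHodgeType (A.prod C).dim (A.prod C).X 1 0 1 (v m) := by
    intro m hm
    rw [hv_apply, ← BettiUniverse.mem_hodge_piece_iff hHD hI hXP (k := 1) (p := 0) (q := 1) rfl]
    have hsplit : φ m = ((φ m).1, 1) := by
      change (φ m).2 = 1 at hm; rw [← hm]
    rw [hsplit]
    exact hcbx1 _
  -- (α) an antisymmetric kind-balanced coefficient function in the adapted letters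
  obtain ⟨ax, hax_bal, hax_anti, hcax⟩ := hg.exists_antisymm_kindBalanced_wordEval_eq v κ hv0 hv1 hp hc
  -- the change of letters to the rational letters
  set G : Matrix _ _ ℂ := eC.toMatrix cbσ with hG
  set G' : Matrix _ _ ℂ := cbσ.toMatrix eC with hG'
  have hG'G : G' * G = 1 := cbσ.toMatrix_mul_toMatrix_flip eC
  have hve : ∀ m, v m = ∑ i, G i m • eL i := fun m => by
    simp only [hv, heL, Module.Basis.map_apply, ← map_smul, ← map_sum]
    congr 1
    exact (eC.sum_toMatrix_smul_self (v := ⇑cbσ) (j := m)).symm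
  have hletters : ∀ j m, avLetters g v (j, m) = ∑ i, G i m • avLetters g eL (j, i) :=
    avLetters_baseChange g G hve
  set aE := colourChangeAt (fun _ : Fin n => G) ax with haE
  have haE_anti : IsAntisymm aE := hax_anti.colourChangeAt _
  have hcaE : wordEval (cupPowOneAlt ℂ (Motives.ComplexPoints X.X) (2 * p)) (avLetters g eL) aE = c := by
    rw [haE, ← wordEval_eq_wordEval_colourChangeAt _ (fun _ : Fin n => G) hletters ax, hcax]
  -- rationality of `aE`
  have hFinj : Function.Injective (exteriorPower.alternatingMapLinearEquiv
      (cupPowOneAlt ℂ (Motives.ComplexPoints X.X) (2 * p))) :=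
    injective_alternatingMapLinearEquiv_cupPowOneAlt X (2 * p)
  obtain ⟨q, hq⟩ := hg.exists_rat_wordEval_eq eL heLQ hcQ
  obtain ⟨q', -, haEq⟩ := haE_anti.exists_eq_algebraMap_of_wordEval_eq hFinj (hg.letterBasis eL)
    (q := q) (by rw [AVSlots.coe_letterBasis, hcaE, hq])
  have hslice_e : ∀ u, wordSlice aE u = wordRepAt ℂ (fun _ : Fin (2 * p) => G) (wordSlice ax u) :=
    fun u => wordSlice_colourChangeAt (fun _ : Fin n => G) ax u
  -- the Hodge operator `Θ` of `H¹(A × C)`: `diag(±1)` in the adapted letters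
  obtain ⟨Θ, hΘ⟩ := exists_hodgeTheta (BettiUniverse.hodge hHD hXP 1)
  have hΘb : ∀ m, Θ (cbσ m) = (if κ m = 0 then (1 : ℂ) else -1) • cbσ m := by
    intro m
    rw [hcbσ]
    change Θ _ = (if (φ m).2 = 0 then (1 : ℂ) else -1) • _
    rcases fin2_eq_zero_or_one₃ (φ m).2 with h0 | h1
    · rw [h0, if_pos rfl]
      have hmem : cbx (φ m) ∈ (BettiUniverse.hodge hHD hXP 1).piece 1 (((1 : ℕ) : ℤ) - 1) := by
        have e : (((1 : ℕ) : ℤ) - 1) = 0 := by norm_num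
        have hsplit : φ m = ((φ m).1, 0) := by rw [← h0]
        rw [e, hsplit]; exact hcbx0 _
      rw [hΘ 1 _ hmem]
      norm_num
    · rw [h1, if_neg one_ne_zero]
      have hmem : cbx (φ m) ∈ (BettiUniverse.hodge hHD hXP 1).piece 0 (((1 : ℕ) : ℤ) - 0) := by
        have e : (((1 : ℕ) : ℤ) - 0) = 1 := by norm_num
        have hsplit : φ m = ((φ m).1, 1) := by rw [← h1]
        rw [e, hsplit]; exact hcbx1 _
      rw [hΘ 0 _ hmem]
      norm_num
  have hΘcb : LinearMap.toMatrix cbσ cbσ Θ = kindDiag κ := by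
    ext i m
    rw [LinearMap.toMatrix_apply, hΘb, map_smul, Module.Basis.repr_self, Finsupp.smul_apply,
      Finsupp.single_apply, kindDiag, Matrix.diagonal_apply, smul_eq_mul, mul_ite, mul_one, mul_zero]
    by_cases him : i = m
    · subst him; rw [if_pos rfl]
    · rw [if_neg (Ne.symm him), if_neg him]
  have hJG : LinearMap.toMatrix eC eC Θ * G = G * kindDiag κ := by
    rw [← hΘcb, hG, linearMap_toMatrix_mul_basis_toMatrix, basis_toMatrix_mul_linearMap_toMatrix]
  have hΘq : ∀ u : Fin (2 * p) → Fin n, wordDerAt ℂ (fun _ : Fin (2 * p) => LinearMap.toMatrix eC eC Θ)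
      (wordSlice (fun w => algebraMap ℚ ℂ (q' w)) u) = 0 := by
    intro u
    rw [← haEq, hslice_e]
    refine wordDerAt_wordRepAt_eq_zero_of_mul_eq ℂ (fun _ : Fin (2 * p) => G) (fun _ => hJG) ?_
    rw [wordDerAt_const]
    exact wordDer_kindDiag_wordSlice_eq_zero κ hax_bal u
  -- the rigid symplectic factor `C`: polarization, Hodge operator, (RIGID), (IDEAL)
  obtain ⟨ψC⟩ : (BettiUniverse.hodge hHD hXC 1).IsPolarizable :=
    smoothProjective_hodgeStructure_isPolarizable_holds hXC (BettiUniverse.realHodgeModel hHD hXC)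
      (BettiUniverse.realHodgeModel_isHodgeSymmetric hHD hXC) 1
  have heffC := BettiUniverse.hodge_isEffective hHD hXC 1
  obtain ⟨Θ₂, hΘ₂⟩ := exists_hodgeTheta (BettiUniverse.hodge hHD hXC 1)
  have hCpos : 0 < C.dim := by rcases hCdim with h' | h' <;> omega
  have hE₂ := exists_eq_smul_one_of_finrank_endAlgebra_eq_one (A := C) hHD hI hCend hCpos
  have hV₂ : Module.finrank ℚ (bettiCohomology C.X 1) = 2 * C.dim := finrank_bettiCohomology_one C
  have h1 : (((1 : ℕ) : ℤ)) = 1 := Nat.cast_one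
  have hrigid : ∀ 𝔤₂ : Submodule ℚ (Module.End ℚ (bettiCohomology C.X 1)),
      (∀ X ∈ 𝔤₂, ∀ X' ∈ 𝔤₂, X * X' - X' * X ∈ 𝔤₂) →
      (∀ X ∈ 𝔤₂, ∀ v w, ψC.form (X v) w + ψC.form v (X w) = 0) → Θ₂ ∈ spanC 𝔤₂ →
      ∀ Y : Module.End ℂ (ℂ ⊗[ℚ] bettiCohomology C.X 1),
        (∀ x y, ψC.form.baseChange ℂ (Y x) y + ψC.form.baseChange ℂ x (Y y) = 0) → Y ∈ spanC 𝔤₂ := by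
    intro 𝔤₂ hbr hskew hΘ𝔤 Y hY
    rcases hCdim with h2C | h3C
    · exact SymplecticTheta.mem_spanC_of_skew _ h1 heffC ψC hE₂ (by rw [hV₂, h2C]) 𝔤₂ hbr hΘ₂ hΘ𝔤 hskew hY
    · exact SymplecticThetaSix.mem_spanC_of_skew _ h1 heffC ψC hE₂ (by rw [hV₂, h3C]) 𝔤₂ hbr hΘ₂ hΘ𝔤 hskew hY
  have hideal : ∀ I : Submodule ℂ (Module.End ℂ (ℂ ⊗[ℚ] bettiCohomology C.X 1)),
      (∀ Y ∈ I, ∀ x y, ψC.form.baseChange ℂ (Y x) y + ψC.form.baseChange ℂ x (Y y) = 0) →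
      (∀ Zc : Module.End ℂ (ℂ ⊗[ℚ] bettiCohomology C.X 1),
        (∀ x y, ψC.form.baseChange ℂ (Zc x) y + ψC.form.baseChange ℂ x (Zc y) = 0) →
          ∀ Y ∈ I, Zc * Y - Y * Zc ∈ I) → I ≠ ⊥ → Θ₂ ∈ I :=
    fun I hIskew hIst hI0 => SymplecticIdeal.theta_mem_of_ne_bot_hodge _ h1 heffC ψC hΘ₂ I hIskew hIst hI0
  -- (SIZE): the `dim 𝔰𝔭_{2g} = g(2g+1)` independent `ψ_C`-skew operators `ψ_C(e_i, ·) e_j + ψ_C(e_j, ·) e_i`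
  -- (`i ≤ j`) of a basis `e` of `H¹(C) ⊗ ℂ`
  set eC₂ : Module.Basis (Fin (2 * C.dim)) ℂ (ℂ ⊗[ℚ] bettiCohomology C.X 1) :=
    (Algebra.TensorProduct.basis ℂ (Module.finBasis ℚ (bettiCohomology C.X 1))).reindex (finCongr hV₂) with heC₂
  have hωalt : ∀ x y, ψC.form.baseChange ℂ x y = -ψC.form.baseChange ℂ y x := fun x y => by
    rw [ψC.form_baseChange_swap y x, Int.negOnePow_odd _ hodd]; norm_num
  set P : {p : Fin (2 * C.dim) × Fin (2 * C.dim) // p.1 ≤ p.2} → Module.End ℂ (ℂ ⊗[ℚ] bettiCohomology C.X 1) :=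
    fun p => (ψC.form.baseChange ℂ (eC₂ p.1.1)).smulRight (eC₂ p.1.2) +
      (ψC.form.baseChange ℂ (eC₂ p.1.2)).smulRight (eC₂ p.1.1) with hPdef
  have hPind : LinearIndependent ℂ P := linearIndependent_pairOp_basis _ ψC.nondegenerate_baseChange eC₂
  have hcard : Fintype.card {p : Fin (2 * C.dim) × Fin (2 * C.dim) // p.1 ≤ p.2} = C.dim * (2 * C.dim + 1) :=
    card_pairs_le C.dim
  set σJ : Fin (C.dim * (2 * C.dim + 1)) ≃ {p : Fin (2 * C.dim) × Fin (2 * C.dim) // p.1 ≤ p.2} :=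
    (Fintype.equivFinOfCardEq hcard).symm with hσJ
  set Z : Fin (C.dim * (2 * C.dim + 1)) → Module.End ℂ (ℂ ⊗[ℚ] bettiCohomology C.X 1) := P ∘ σJ with hZdef
  have hZind : LinearIndependent ℂ Z := hPind.comp _ σJ.injective
  have hZskew : ∀ i x y, ψC.form.baseChange ℂ (Z i x) y + ψC.form.baseChange ℂ x (Z i y) = 0 := fun i x y => by
    rw [hZdef, Function.comp_apply, hPdef]
    exact SymplecticIdeal.pairOp_skew _ hωalt (eC₂ (σJ i).1.1) (eC₂ (σJ i).1.2) x y
  have hdim' : ∀ 𝔤₁ : Submodule ℚ (Module.End ℚ (bettiCohomology A.X 1)),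
      (∀ Y ∈ 𝔤₁, ∀ a : (BettiUniverse.hodge hHD hXA 1).endAlg,
        Y * (a : Module.End ℚ (bettiCohomology A.X 1)) = (a : Module.End ℚ (bettiCohomology A.X 1)) * Y) →
      (∀ Y ∈ 𝔤₁, ∀ v w, ψ.form (Y v) w + ψ.form v (Y w) = 0) →
      Module.finrank ℚ 𝔤₁ < C.dim * (2 * C.dim + 1) :=
    fun 𝔤₁ hcomm hskew => hdimA 𝔤₁ hcomm hskew
  -- the coefficient function, refined to slot-and-place colours
  refine ⟨placeRefine φ ax, ?_, fun U τ N hN => ?_⟩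
  · rw [← hcax]
    have hx : (fun jr : (Fin n × (T ⊕ Fin h)) × Fin 2 => avLetters g v (jr.1.1, φ.symm (jr.1.2, jr.2))) =
        fun jr : (Fin n × (T ⊕ Fin h)) × Fin 2 => complexBetti.map (g jr.1.1).hom.hom.hom 1
          (Sum.elim
            (fun τ => complexBetti.map (Motives.AbelianVariety.fst A C).hom.hom.hom 1
              (ofRatClassBaseChange (Motives.ComplexPoints A.X) 1 (b τ jr.2 : ℂ ⊗[ℚ] bettiCohomology A.X 1)))
            (fun i => complexBetti.map (Motives.AbelianVariety.snd A C).hom.hom.hom 1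
              (ofRatClassBaseChange (Motives.ComplexPoints C.X) 1 (cC (i, jr.2))))
            jr.1.2) := by
      funext jr
      rw [avLetters_apply, hv_apply, Equiv.apply_symm_apply, hcbx]
      obtain ⟨⟨j, t⟩, r⟩ := jr
      rcases t with τ | i
      · simp only [Sum.elim_inl]
        congr 1
        rw [hι₁, ← ofRatClassBaseChangeEquiv_apply (hX := hXP), ← ofRatClassBaseChangeEquiv_apply (hX := hXA),
          complexBetti_map_ofRatClassBaseChangeEquiv hXP hXA]
      · simp only [Sum.elim_inr]
        congr 1
        rw [hι₂, ← ofRatClassBaseChangeEquiv_apply (hX := hXP), ← ofRatClassBaseChangeEquiv_apply (hX := hXC),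
          complexBetti_map_ofRatClassBaseChangeEquiv hXP hXC]
    rw [← hx]
    exact wordEval_placeRefine _ φ (avLetters g v) ax
  · refine wordDerAt_colourOp_placeRefine_eq_zero φ (Sum.inl τ) N (fun u => ?_) U
    -- the product Lie step (Goursat form) for `Y := pr_A^* ∘ (0 ⊕ N ⊕ 0 at place τ) ∘ ι_A^*`
    set Y := ι₁.baseChange ℂ ∘ₗ RealPlaces.assemble hint b (Pi.single τ N) ∘ₗ π₁.baseChange ℂ with hY
    have htr : ∀ τ', ((Pi.single τ N : T → Matrix (Fin 2) (Fin 2) ℂ) τ').trace = 0 := by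
      intro τ'
      rw [Pi.single_apply]
      split_ifs
      · exact hN
      · exact Matrix.trace_zero _ _
    have hL := wordDerAt_assemble_eq_zero_of_realBlocks_times_symplectic hodd (BettiUniverse.hodge hHD hXP 1)
      (BettiUniverse.hodge hHD hXA 1) (BettiUniverse.hodge hHD hXC 1) hπι₁ hπι₂ hπ₁ι₂ hπ₂ι₁ hsum hι₁F hι₂F ψ hself
      σ hreal hint h2 b ψC hΘ₂ hrigid hideal hdim' Z hZind hZskew eQ q' hΘ hΘq (Pi.single τ N) htr u
    rw [← haEq, hslice_e] at hL
    have hYG : ∀ _t : Fin (2 * p), LinearMap.toMatrix eC eC Y * G = G * LinearMap.toMatrix cbσ cbσ Y :=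
      fun _ => by rw [hG, linearMap_toMatrix_mul_basis_toMatrix, basis_toMatrix_mul_linearMap_toMatrix]
    -- the matrix of `Y` in the block letters: `N` at the places `(j, inl τ)`, `0` elsewhere
    have e11 : ∀ x, π₁.baseChange ℂ (ι₁.baseChange ℂ x) = x := fun x => by
      rw [← LinearMap.comp_apply (f := π₁.baseChange ℂ), hπι₁C, LinearMap.id_apply]
    have e12 : ∀ y, π₁.baseChange ℂ (ι₂.baseChange ℂ y) = 0 := fun y => by
      rw [← LinearMap.comp_apply (f := π₁.baseChange ℂ), hπ₁ι₂C, LinearMap.zero_apply]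
    have hblk : LinearMap.toMatrix cbσ cbσ Y = blockLift φ (Pi.single (Sum.inl τ) N) := by
      refine toMatrix_eq_blockLift_of_apply_basis φ cbσ _ Y fun m => ?_
      rw [hcbσ m]
      have hb' : ∀ a, cbσ (φ.symm ((φ m).1, a)) = cbx ((φ m).1, a) := fun a => by
        rw [hcbσ, Equiv.apply_symm_apply]
      simp only [hb']
      obtain ⟨t, r⟩ := φ m
      rcases t with τ' | i
      · simp only [hcbx, Sum.elim_inl]
        rw [hY, LinearMap.comp_apply, LinearMap.comp_apply, e11,
          RealPlaces.assemble_apply_basis, map_sum]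
        refine Finset.sum_congr rfl fun a _ => ?_
        rw [map_smul, Pi.single_apply, Pi.single_apply]
        by_cases hτ : τ' = τ
        · subst hτ; simp
        · simp [hτ]
      · simp only [hcbx, Sum.elim_inr]
        rw [hY, LinearMap.comp_apply, LinearMap.comp_apply, e12, map_zero, map_zero]
        symm
        refine Finset.sum_eq_zero fun a _ => ?_
        rw [Pi.single_eq_of_ne (Sum.inr_ne_inl), Matrix.zero_apply, zero_smul]
    have h3 : wordRepAt ℂ (fun _ : Fin (2 * p) => G)
        (wordDerAt ℂ (fun _ : Fin (2 * p) => blockLift φ (Pi.single (Sum.inl τ) N)) (wordSlice ax u)) = 0 := by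
      rw [← hblk, wordRepAt_wordDerAt_of_mul_eq ℂ (fun _ : Fin (2 * p) => G) hYG, hL]
    exact wordRepAt_injective ℂ (g := fun _ : Fin (2 * p) => G) (g' := fun _ : Fin (2 * p) => G')
      (funext fun _ => hG'G) (by rw [h3, map_zero])

open scoped Classical in
/-- **The invariance theorem with the cruder SIZE bound `< 2 dim C`** (the form first landed; a corollary of
`AVSlots.exists_coeff_killed_at_real_places_of_prod_endRankOne` since `2 dim C ≤ dim C (2 dim C + 1)`).
**The INVARIANCE THEOREM for slots over `A × C`, `A` with real `𝔰𝔩₂`-block data, `C` an abelian surface or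
threefold with `End⁰(C) = ℚ` (Hazama 1989 / Moonen–Zarhin 1999 Thm. (3.2)(1), Lie step; Hazama 1983 §3).** Let
`ψ` be a polarization of `H¹(A(ℂ); ℚ)` with `End_Hdg` self-adjoint, `σ_τ` (`τ ∈ T`) REAL characters of
`End_Hdg(H¹(A))` whose two-dimensional eigenblocks `V_τ` decompose `H¹(A) ⊗ ℂ`, `b_τ` Hodge-adapted block bases,
such that every rational space of `ψ`-skew operators of `H¹(A)` commuting with `End_Hdg(H¹(A))` has dimension
`< 2 dim C` (SIZE; automatic for an elliptic curve, `finrank_lt_of_forall_skew`); let `C` have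
`finrank_ℚ End⁰(C) = 1` and `dim C ∈ {2, 3}`, and let `X` be an abelian variety with slots `g` over `A × C`. Then
there is a Hodge-adapted pair basis `(c_i^0, c_i^1)_{i < h}` of `H¹(C) ⊗ ℂ` (`c_i^0 ∈ H^{1,0}`, `c_i^1 ∈ H^{0,1}`)
such that every rational class `c` of type `(p,p)` on `X` (`p ≥ 1`) is `∑_w a(w) · x_w` in the letters
`x((j, inl τ), r) = g_j^* pr_A^* b_τ^r`, `x((j, inr i), r) = g_j^* pr_C^* c_i^r`, for a coefficient function `a`
such that for every slot-and-place word `U`, every `A`-place `τ` and every trace-free `N ∈ M₂(ℂ)` the operator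
`N` placed at the positions of place `inl τ` kills the slice `a(U, −)`: the tensor invariants of `X` are
invariants of `(⊕_τ 𝔰𝔩(V_τ)) ⊕ 0 ⊆ Lie Hg(A) ⊕ Lie Hg(C)` («`Hg(X₁ × X₂) = Hg(X₁) × Hg(X₂)`»).
[cite: MoonenZarhin1999LowDim, §3 Thm. (3.2)(1)] [cite: Hazama1989, Thm. (= Gordon 7.6.2)]
[cite: Hazama1983, Thm. (1.1) and §3 (pp. 305–306)] [cite: Ribet1983, Thm. 0–1] -/
theorem AVSlots.exists_coeff_killed_at_real_places_of_prod_generic [HodgeTensorFacts.{0, 0}]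
    (hg : AVSlots (A.prod C) X g)
    (hHD : exists_isReal_hodgeModel) (hI : hodgePQ_independent_of_hodgeModel)
    {T : Type} [Fintype T] [DecidableEq T]
    (ψ : (BettiUniverse.hodge hHD (AbelianVariety.isSmoothProjective_holds (A := A)) 1).Polarization)
    (hself : ∀ a : (BettiUniverse.hodge hHD (AbelianVariety.isSmoothProjective_holds (A := A)) 1).endAlg,
      LinearMap.IsAdjointPair ψ.form ψ.form (a : Module.End ℚ (bettiCohomology A.X 1))
        (a : Module.End ℚ (bettiCohomology A.X 1)))
    (σ : T → ((BettiUniverse.hodge hHD (AbelianVariety.isSmoothProjective_holds (A := A)) 1).endAlg →+* ℂ))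
    (hreal : ∀ τ, (starRingEnd ℂ).comp (σ τ) = σ τ)
    (hint : DirectSum.IsInternal fun τ =>
      (BettiUniverse.hodge hHD (AbelianVariety.isSmoothProjective_holds (A := A)) 1).eigenBlock (σ τ))
    (h2 : ∀ τ, Module.finrank ℂ
      ((BettiUniverse.hodge hHD (AbelianVariety.isSmoothProjective_holds (A := A)) 1).eigenBlock (σ τ)) = 2)
    (b : ∀ τ, Module.Basis (Fin 2) ℂ
      ((BettiUniverse.hodge hHD (AbelianVariety.isSmoothProjective_holds (A := A)) 1).eigenBlock (σ τ)))
    (hb0 : ∀ τ, (b τ 0 : ℂ ⊗[ℚ] bettiCohomology A.X 1) ∈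
      (BettiUniverse.hodge hHD (AbelianVariety.isSmoothProjective_holds (A := A)) 1).piece 1 0)
    (hb1 : ∀ τ, (b τ 1 : ℂ ⊗[ℚ] bettiCohomology A.X 1) ∈
      (BettiUniverse.hodge hHD (AbelianVariety.isSmoothProjective_holds (A := A)) 1).piece 0 1)
    (hdimA : ∀ 𝔤₁ : Submodule ℚ (Module.End ℚ (bettiCohomology A.X 1)),
      (∀ Y ∈ 𝔤₁, ∀ a : (BettiUniverse.hodge hHD (AbelianVariety.isSmoothProjective_holds (A := A)) 1).endAlg,
        Y * (a : Module.End ℚ (bettiCohomology A.X 1)) = (a : Module.End ℚ (bettiCohomology A.X 1)) * Y) →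
      (∀ Y ∈ 𝔤₁, ∀ v w, ψ.form (Y v) w + ψ.form v (Y w) = 0) → Module.finrank ℚ 𝔤₁ < 2 * C.dim)
    (hCend : Module.finrank ℚ C.endAlgebra = 1) (hCdim : C.dim = 2 ∨ C.dim = 3) :
    ∃ (h : ℕ) (cC : Module.Basis (Fin h × Fin 2) ℂ (ℂ ⊗[ℚ] bettiCohomology C.X 1)),
      (∀ i, cC (i, 0) ∈ (BettiUniverse.hodge hHD (AbelianVariety.isSmoothProjective_holds (A := C)) 1).piece 1 0) ∧
      (∀ i, cC (i, 1) ∈ (BettiUniverse.hodge hHD (AbelianVariety.isSmoothProjective_holds (A := C)) 1).piece 0 1) ∧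
      ∀ {p : ℕ}, 0 < p → ∀ {c : complexBetti X.X (2 * p)}, IsRationalClass c →
        IsOfHodgeType X.dim X.X (2 * p) p p c →
        ∃ a : (Fin (2 * p) → (Fin n × (T ⊕ Fin h)) × Fin 2) → ℂ,
          wordEval (cupPowOneAlt ℂ (Motives.ComplexPoints X.X) (2 * p))
            (fun jr : (Fin n × (T ⊕ Fin h)) × Fin 2 => complexBetti.map (g jr.1.1).hom.hom.hom 1
              (Sum.elim
                (fun τ => complexBetti.map (Motives.AbelianVariety.fst A C).hom.hom.hom 1
                  (ofRatClassBaseChange (Motives.ComplexPoints A.X) 1 (b τ jr.2 : ℂ ⊗[ℚ] bettiCohomology A.X 1)))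
                (fun i => complexBetti.map (Motives.AbelianVariety.snd A C).hom.hom.hom 1
                  (ofRatClassBaseChange (Motives.ComplexPoints C.X) 1 (cC (i, jr.2))))
                jr.1.2)) a = c ∧
          ∀ (U : Fin (2 * p) → Fin n × (T ⊕ Fin h)) (τ : T) (N : Matrix (Fin 2) (Fin 2) ℂ), N.trace = 0 →
            wordDerAt ℂ (colourOp ℂ (fun t => (U t).2) (Sum.inl τ) N) (wordSlice a U) = 0 :=
  hg.exists_coeff_killed_at_real_places_of_prod_endRankOne hHD hI ψ hself σ hreal hint h2 b hb0 hb1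
    (fun 𝔤₁ hcomm hskew => lt_of_lt_of_le (hdimA 𝔤₁ hcomm hskew)
      (by rcases hCdim with h | h <;> rw [h] <;> norm_num)) hCend hCdim

end Invariance

end Literature.AlgebraicGeometry.HodgeTheory

end
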